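import Mathlib
import Summits.KontsevichZagierPeriods.Zeta5Search.BrickLaurent

/-!
# BrickPartialFractions — the partial-fraction decomposition of the brick kernel:
`R_n(t) = Σ_{K=0}^{n} Σ_{s=1}^{A} c_{K,s}(n)·(t+K)^{−s}` with `c_{K,s}(n) = BrickLaurent.cell A B ε n K s` (cell zeta5-irr)

HONEST FRAMING: systematic search; no irrationality claim unless certified. INSTRUMENT lemma of the ζ(5)
census cell zeta5-irr (HOME `run/shared/lean/pub/zeta5-irr/`; memo `zi-p2/probes/B8/thm6/THEOREM6.md` §0
«`R_n(t) := n!^{A−2B}(t + n/2)(t−n)_n^B(t+n+1)_n^B/(t)_{n+1}^A = Σ_{K=0}^{n}Σ_{s=1}^{A}c_{K,s}(n)(t+K)^{−s}`;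
`x_s(n) := Σ_Kc_{K,s}(n)`, `x_0(n) := −Σ_KΣ_sc_{K,s}(n)H_K^{(s)}`, `cell_K^{(0)} := −Σ_sc_{K,s}H_K^{(s)}`»; design note
HOME `zi-eng/lean-g8/DESIGN-CELLS.md`). Nothing here is about ζ(5); no irrationality content; filing moves no rung.
Filed by the engine seat zi-eng (g8); sequel of `BrickLaurent` (the cells as Taylor coefficients, TRUNCATION lemma).

## The statement

For `2B ≤ A`, `ε < A` (so that `deg(numerator) = ε + 2nB < (n+1)A = deg(denominator)`) and every `t ∉ {0, −1, …, −n}`: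

**`brickKernel A B ε n t = Σ_{K=0}^{n} Σ_{s=1}^{A} cell A B ε n K s / (t+K)^s`** (`brickKernel_eq_sum_cell`),

i.e. the Taylor-coefficient cells of `BrickLaurent` ARE the partial-fraction coefficients of zi-p2's THEOREMS 3–7.
Proof (pure algebra in `ℚ[X]`): with `PP_K := Σ_{d<A}[T^d]F_K·(X+K)^d` (`principalPoly`), the polynomial
`E := kerNum − Σ_K PP_K·kerDenErase_K` is divisible by every `(X+K)^A` (TRUNCATION at `−K`; the other summands contain
the factor `(X+K)^A`), hence by `kerDen = ∏_K(X+K)^A` (pairwise coprime), and `deg E < (n+1)A = deg kerDen`, so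
`E = 0` (`kerNum_eq_sum`); dividing by `kerDen(t) = (t+K)^A·kerDenErase_K(t)` pole by pole gives the claim.
Also recorded (definitions only, zi-p2's names): `xCoeff A B ε n s = x_s(n) := Σ_K c_{K,s}(n)`, `cellZero A B ε n K =
cell^{(0)}_K := −Σ_{s=1}^{A} c_{K,s}(n)·H_K^{(s)}` (`H_K^{(s)} = Σ_{i=1}^{K} i^{−s}`), `xZero A B ε n = x_0(n) := Σ_K cell^{(0)}_K`.
-/

namespace Summit.KontsevichZagierPeriods.Zeta5Search.BrickPartialFractions

open Finset Nat Polynomial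
open Summit.KontsevichZagierPeriods.Zeta5Search.BrickKernelFrobenius (brickKernel)
open Summit.KontsevichZagierPeriods.Zeta5Search.BrickLaurent (expandAt laurentSeries laurent cell kerNum kerDen
  kerDenErase brickKernel_eq_div eval_kerDen eval_kerDenErase eval_kerDenErase_neg_ne_zero X_sub_C_pow_dvd)

noncomputable section

/-! ## zi-p2's sums over the cells (definitions) -/

/-- `x_s(n) := Σ_{K=0}^{n} c_{K,s}(n)` — the coefficient of `ζ(s)` in the linear form `Σ_{t≥1}R_n(t)` (zi-p2 §0). -/
def xCoeff (A B ε n s : ℕ) : ℚ := ∑ K ∈ range (n + 1), cell A B ε n K s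

/-- `cell^{(0)}_K(n) := −Σ_{s=1}^{A} c_{K,s}(n)·H_K^{(s)}`, `H_K^{(s)} = Σ_{i=1}^{K} i^{−s}` (zi-p2 §0). -/
def cellZero (A B ε n K : ℕ) : ℚ :=
  -∑ s ∈ Icc 1 A, cell A B ε n K s * ∑ i ∈ Icc 1 K, 1 / (i : ℚ) ^ s

/-- `x_0(n) := Σ_{K=0}^{n} cell^{(0)}_K(n) = −Σ_KΣ_s c_{K,s}(n)H_K^{(s)}` — the constant term of the linear form (zi-p2 §0). -/
def xZero (A B ε n : ℕ) : ℚ := ∑ K ∈ range (n + 1), cellZero A B ε n K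

/-! ## The principal parts as polynomials -/

/-- `PP_K(X) := Σ_{d<A} [T^d]F_K · (X + K)^d` — the principal part of `R_n` at `−K` multiplied by `(X+K)^A`. -/
def principalPoly (A B ε n K : ℕ) : ℚ[X] := ∑ d ∈ range A, C (laurent A B ε n K d) * (X + C (K : ℚ)) ^ d

/-- TRUNCATION at the pole `−K`: `(X+K)^A ∣ kerNum − kerDenErase_K·PP_K`. -/
theorem X_add_C_pow_dvd_kerNum_sub (A B ε n K : ℕ) :
    (X + C (K : ℚ)) ^ A ∣ kerNum A B ε n - kerDenErase A n K * principalPoly A B ε n K := by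
  have h := X_sub_C_pow_dvd (-(K : ℚ)) (kerNum A B ε n) (kerDenErase A n K) (eval_kerDenErase_neg_ne_zero A n K) A
  have e : (X - C (-(K : ℚ)) : ℚ[X]) = X + C (K : ℚ) := by rw [C_neg, sub_neg_eq_add]
  simpa only [e, principalPoly, laurent, laurentSeries] using h

/-- The other principal parts vanish to order `A` at `−K`: `(X+K)^A ∣ kerDenErase_{K'}` for `K ≠ K'`, `K ≤ n`. -/
theorem X_add_C_pow_dvd_kerDenErase (A : ℕ) {n K K' : ℕ} (hK : K ≤ n) (hKK' : K ≠ K') :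
    (X + C (K : ℚ)) ^ A ∣ kerDenErase A n K' := by
  have hm : K ∈ (range (n + 1)).erase K' := mem_erase.2 ⟨hKK', mem_range.2 (by omega)⟩
  rw [kerDenErase, ← Finset.prod_pow]
  exact Finset.dvd_prod_of_mem (fun m : ℕ => (X + C (m : ℚ)) ^ A) hm

/-- `deg kerNum ≤ ε + nB + nB`. -/
theorem natDegree_kerNum_le (A B ε n : ℕ) : (kerNum A B ε n).natDegree ≤ ε + n * B + n * B := by
  have h1 : (∏ m ∈ Icc 1 n, (X - C (m : ℚ))).natDegree ≤ n := by
    refine (natDegree_prod_le _ _).trans (le_of_eq ?_)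
    rw [Finset.sum_congr rfl fun (m : ℕ) _ => natDegree_X_sub_C (m : ℚ), sum_const, Nat.card_Icc, smul_eq_mul, mul_one,
      Nat.add_sub_cancel]
  have h2 : (∏ m ∈ Icc 1 n, (X + C (n : ℚ) + C (m : ℚ))).natDegree ≤ n := by
    refine (natDegree_prod_le _ _).trans (le_of_eq ?_)
    rw [Finset.sum_congr rfl fun m _ => by rw [add_assoc, ← C_add, natDegree_X_add_C], sum_const, Nat.card_Icc,
      smul_eq_mul, mul_one, Nat.add_sub_cancel]
  have h3 : (C ((n ! : ℚ) ^ (A - 2 * B)) * (X + C ((n : ℚ) / 2)) ^ ε).natDegree ≤ ε := by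
    refine (natDegree_C_mul_le _ _).trans (natDegree_pow_le.trans ?_)
    rw [natDegree_X_add_C, mul_one]
  have h4 : ((∏ m ∈ Icc 1 n, (X - C (m : ℚ))) ^ B).natDegree ≤ n * B :=
    natDegree_pow_le.trans (by rw [mul_comm]; exact Nat.mul_le_mul_right _ h1)
  have h5 : ((∏ m ∈ Icc 1 n, (X + C (n : ℚ) + C (m : ℚ))) ^ B).natDegree ≤ n * B :=
    natDegree_pow_le.trans (by rw [mul_comm]; exact Nat.mul_le_mul_right _ h2)
  unfold kerNum
  exact natDegree_mul_le_of_le (natDegree_mul_le_of_le h3 h4) h5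

/-- `deg PP_K ≤ A − 1`. -/
theorem natDegree_principalPoly_le (A B ε n K : ℕ) : (principalPoly A B ε n K).natDegree ≤ A - 1 := by
  unfold principalPoly
  refine natDegree_sum_le_of_forall_le _ _ fun d hd => ?_
  refine natDegree_mul_le.trans ?_
  rw [natDegree_C, zero_add]
  refine natDegree_pow_le.trans ?_
  rw [natDegree_X_add_C, mul_one]
  have := mem_range.1 hd; omega

/-- `deg kerDenErase_K ≤ nA` for `K ≤ n`. -/
theorem natDegree_kerDenErase_le (A : ℕ) {n K : ℕ} (hK : K ≤ n) : (kerDenErase A n K).natDegree ≤ n * A := by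
  unfold kerDenErase
  refine natDegree_pow_le.trans ?_
  rw [mul_comm]
  refine Nat.mul_le_mul_right _ ((natDegree_prod_le _ _).trans (le_of_eq ?_))
  rw [Finset.sum_congr rfl fun (m : ℕ) _ => natDegree_X_add_C (m : ℚ), sum_const, smul_eq_mul, mul_one,
    card_erase_of_mem (mem_range.2 (by omega)), card_range, Nat.add_sub_cancel]

/-- `kerDen` is monic of degree `(n+1)A`. -/
theorem monic_kerDen (A n : ℕ) : (kerDen A n).Monic ∧ (kerDen A n).natDegree = (n + 1) * A := by
  have hm : (∏ m ∈ range (n + 1), (X + C (m : ℚ))).Monic := monic_prod_of_monic _ _ fun m _ => monic_X_add_C _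
  refine ⟨hm.pow A, ?_⟩
  rw [kerDen, hm.natDegree_pow, natDegree_prod_of_monic _ _ fun m _ => monic_X_add_C _]
  simp only [natDegree_X_add_C, sum_const, card_range, smul_eq_mul, mul_one]
  ring

/-- **The polynomial identity**: `kerNum = Σ_{K≤n} PP_K · kerDenErase_K` (`2B ≤ A`, `ε < A`). -/
theorem kerNum_eq_sum {A B : ℕ} (hAB : 2 * B ≤ A) {ε : ℕ} (hε : ε < A) (n : ℕ) :
    kerNum A B ε n = ∑ K ∈ range (n + 1), principalPoly A B ε n K * kerDenErase A n K := by
  set E := kerNum A B ε n - ∑ K ∈ range (n + 1), principalPoly A B ε n K * kerDenErase A n K with hE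
  -- every `(X+K)^A` divides `E`
  have hdvd : ∀ K ∈ range (n + 1), (X + C (K : ℚ)) ^ A ∣ E := by
    intro K hK
    have hKn : K ≤ n := by have := mem_range.1 hK; omega
    rw [hE, ← Finset.add_sum_erase _ _ hK, ← sub_sub, mul_comm (principalPoly A B ε n K)]
    refine dvd_sub (X_add_C_pow_dvd_kerNum_sub A B ε n K) (Finset.dvd_sum fun K' hK' => ?_)
    exact Dvd.dvd.mul_left (X_add_C_pow_dvd_kerDenErase A hKn (ne_of_mem_erase hK').symm) _
  -- hence `kerDen ∣ E`
  have hden : kerDen A n ∣ E := by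
    rw [kerDen, ← Finset.prod_pow]
    refine Finset.prod_dvd_of_coprime (fun K _ K' _ hKK' => ?_) hdvd
    have e : ∀ L : ℕ, (X + C (L : ℚ) : ℚ[X]) = X - C (-(L : ℚ)) := fun L => by rw [C_neg, sub_neg_eq_add]
    show IsCoprime ((X + C (K : ℚ)) ^ A) ((X + C (K' : ℚ)) ^ A)
    rw [e K, e K']
    refine (isCoprime_X_sub_C_of_isUnit_sub ?_).pow
    rw [neg_sub_neg]
    exact isUnit_iff_ne_zero.2 (sub_ne_zero.2 (by exact_mod_cast (Ne.symm hKK')))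
  -- and `deg E < deg kerDen`
  have hA : 0 < A := by omega
  have hdeg : E.natDegree < (kerDen A n).natDegree := by
    rw [(monic_kerDen A n).2]
    refine lt_of_le_of_lt (natDegree_sub_le _ _) (max_lt ?_ ?_)
    · refine lt_of_le_of_lt (natDegree_kerNum_le A B ε n) ?_
      have : n * B + n * B ≤ n * A := by rw [← mul_add, ← two_mul]; exact Nat.mul_le_mul_left n hAB
      nlinarith
    · refine lt_of_le_of_lt (natDegree_sum_le_of_forall_le _ _ fun K hK => natDegree_mul_le.trans
        (Nat.add_le_add (natDegree_principalPoly_le A B ε n K)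
          (natDegree_kerDenErase_le A (by have := mem_range.1 hK; omega)))) ?_
      rw [add_mul, one_mul]; omega
  have hE0 : E = 0 := eq_zero_of_dvd_of_natDegree_lt hden hdeg
  rw [hE, sub_eq_zero] at hE0
  exact hE0

/-- **PARTIAL FRACTIONS.** For `2B ≤ A`, `ε < A` and `t` with `t + m ≠ 0` for all `m ≤ n`:
`brickKernel A B ε n t = Σ_{K=0}^{n} Σ_{s=1}^{A} cell A B ε n K s / (t+K)^s`. -/
theorem brickKernel_eq_sum_cell {A B : ℕ} (hAB : 2 * B ≤ A) {ε : ℕ} (hε : ε < A) {n : ℕ} {t : ℚ}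
    (ht : ∀ m ≤ n, t + m ≠ 0) :
    brickKernel A B ε n t = ∑ K ∈ range (n + 1), ∑ s ∈ Icc 1 A, cell A B ε n K s / (t + K) ^ s := by
  have hnum := congrArg (eval t) (kerNum_eq_sum hAB hε n)
  rw [eval_finsetSum] at hnum
  rw [brickKernel_eq_div, hnum, Finset.sum_div]
  refine Finset.sum_congr rfl fun K hK => ?_
  have hKn : K ≤ n := by have := mem_range.1 hK; omega
  have htK : t + K ≠ 0 := ht K hKn
  -- `kerDen(t) = (t+K)^A · kerDenErase_K(t)` and `kerDenErase_K(t) ≠ 0`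
  have hsplit : (kerDen A n).eval t = (t + K) ^ A * (kerDenErase A n K).eval t := by
    rw [eval_kerDen, eval_kerDenErase, ← mul_pow, Finset.mul_prod_erase (range (n + 1)) (fun m : ℕ => t + (m : ℚ)) hK]
  have hDE : (kerDenErase A n K).eval t ≠ 0 := by
    rw [eval_kerDenErase]
    refine pow_ne_zero _ (Finset.prod_ne_zero_iff.2 fun m hm => ht m ?_)
    have := mem_range.1 (mem_erase.1 hm).2; omega
  rw [eval_mul, hsplit, mul_div_mul_right _ _ hDE, principalPoly, eval_finsetSum, Finset.sum_div]
  simp only [eval_mul, eval_C, eval_pow, eval_add, eval_X]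
  -- reindex `d = A − s`
  refine Finset.sum_nbij' (fun d => A - d) (fun s => A - s) (fun d hd => ?_) (fun s hs => ?_) (fun d hd => ?_)
    (fun s hs => ?_) (fun d hd => ?_)
  · have := mem_range.1 hd; rw [mem_Icc]; omega
  · have := mem_Icc.1 hs; rw [mem_range]; omega
  · have := mem_range.1 hd; omega
  · have := mem_Icc.1 hs; omega
  · have hd' := mem_range.1 hd
    rw [cell, show A - (A - d) = d by omega, div_eq_div_iff (pow_ne_zero _ htK) (pow_ne_zero _ htK), mul_assoc,
      ← pow_add, show d + (A - d) = A by omega]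

/-- The same with the inner sum written over zi-p2's `s = 1, …, A` and the outer over `K = 0, …, n`, as a
statement about `x_s`: `Σ_{t}`-free form `R_n(t) = Σ_s Σ_K c_{K,s}(n)(t+K)^{−s}` (sums exchanged). -/
theorem brickKernel_eq_sum_sum {A B : ℕ} (hAB : 2 * B ≤ A) {ε : ℕ} (hε : ε < A) {n : ℕ} {t : ℚ}
    (ht : ∀ m ≤ n, t + m ≠ 0) :
    brickKernel A B ε n t = ∑ s ∈ Icc 1 A, ∑ K ∈ range (n + 1), cell A B ε n K s / (t + K) ^ s := by
  rw [brickKernel_eq_sum_cell hAB hε ht, Finset.sum_comm]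

/-- Sanity instance (`(A,B,ε) = (2,1,0)`, `n = 0`: `R_0(t) = 1/t²`, one pole, cells `c_{0,2} = 1`, `c_{0,1} = 0`):
the decomposition theorem specialises to `brickKernel 2 1 0 0 t = Σ_{s=1}^{2} cell 2 1 0 0 0 s / t^s`. -/
example {t : ℚ} (ht : ∀ m : ℕ, m ≤ 0 → t + (m : ℚ) ≠ 0) :
    brickKernel 2 1 0 0 t = ∑ K ∈ range 1, ∑ s ∈ Icc 1 2, cell 2 1 0 0 K s / (t + K) ^ s :=
  brickKernel_eq_sum_cell (by norm_num) (by norm_num) ht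

end

end Summit.KontsevichZagierPeriods.Zeta5Search.BrickPartialFractions
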